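import Summits.BirchSwinnertonDyer.Rank1Residual.Supersingular.RankZeroKimTamDefectRecord9950f1LevelTwo
import Summits.BirchSwinnertonDyer.Rank1Residual.Supersingular.KuriharaTwistCertsK9PairN6
import Summits.BirchSwinnertonDyer.Rank1Residual.Supersingular.KuriharaTwistRecordLevelKPairLevel
import HarnessLib

/-!
# N6 TAM-DEFECT (X8, `r_an = 0`, `ord₃ ∏c_ℓ = 1`) — STANDARD-CURRENCY twin of my `9950f1` level-two record: `bsdp_x8r0kim9L_9950f1_n2674657`
# = `bsdp_x8r0kim9_9950f1_n2674657` (p320636) with the datum `hδ` replaced by the landed two-prime depth-2 record + rounding certificate +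
# the engine's ENCLOSURE `hballL`

Cell `b2b-bsdres`, supersingular family, prover B = unit `b2b-bsdres-additive-p3` (gen 25; class lead N6·O3).  Topic file; namespace
`Summit.BirchSwinnertonDyer.Rank1Residual.Supersingular`.  ONE THEOREM: one `exact` onto my landed record with `hδ :=` this gen's pair-level bridge
`kuriharaNumber_pairLevel_ne_zero_of_ainvs_of_certifiedK_of_LValueBall` applied to `certK9_X8r0_9950f1` + `certRK9_X8r0_9950f1` (implementation 3d,
prover A's engine UNCHANGED, kit j157257); good reduction at 3, `1531, 1747 ∈ 𝒫₂` (point counts `1539`, `1737` by `countPointsFast`) and irreducibility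
(`surj_x8r0_9950f1_3`) re-derived in the kernel.  No definition, no named fact, nothing booked; X8 stays CONSTRUCTION-SHAPED; the record stays
CONDITIONAL on Kim 2025 (OPEN) and keeps its other displayed binders (Wuthrich Prop. 21 `hW`, GZK, modularity, period transfer at 3, `r_an = 0`,
the Tamagawa datum `htam`).

HONEST FRAMING (run/shared/lean/b2b/bsd-rank1-residual/, verbatim in every file): the goal of the
cell is to DELETE the COMBINATION-SHAPED residual classes of the Birch–Swinnerton-Dyer formula for
ALL analytic-rank `≤ 1` elliptic curves over `ℚ` — "full BSD formula for every rank `≤ 1` curve in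
class `C`" assembled STRICTLY from published theorems — so that the rank-`≤ 1` remainder becomes
exactly the CONSTRUCTION-SHAPED classes, which are TYPED (missing-input `Prop`s), NOT attempted.
This is not "finishing BSD".  EVERY theorem here is CONDITIONAL on the ANNOUNCED preprint C.-H. Kim
(app. R. Pollack), arXiv:2505.09121 Thm. 1.1 (`hK25s`, OPEN binder) — a typed OPEN hypothesis, never a theorem.

References: [Kim2025RefinedTNC] Thm. 1.1 (ANNOUNCED, OPEN); [Kim2022StructureSelmer] §1.2.2, §1.4.3, Thm. 1.9 (6); [MazurTateTeitelbaum1986Invent] §I.8;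
[CremonaAlgorithms1997] §2.8; [Cremona2006] Table 1; cell table class-closure/O3/KIM-STD-additive-p3-g25.md (N6 row).
-/

set_option autoImplicit false

noncomputable section

open scoped Classical MatrixGroups ModularForm

open CongruenceSubgroup WeierstrassCurve Literature.NumberTheory.EllipticCurves
  Literature.NumberTheory.EllipticCurves.ModularForms
  Literature.NumberTheory.EllipticCurves.Rank1Residual
  Literature.NumberTheory.EllipticCurves.Rank1Residual.Typed
  Literature.NumberTheory.EllipticCurves.Rank1Residual.X11RankOneCertificates
  Literature.NumberTheory.EllipticCurves.Wuthrich2014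
  Summit.BirchSwinnertonDyer.BirchSwinnertonDyer.Rank1Residual.IntModel
  Summit.BirchSwinnertonDyer.BirchSwinnertonDyer.Rank1Residual.X11RankOne
  Summit.BirchSwinnertonDyer.Rank1Residual.X11b
  Summit.BirchSwinnertonDyer.Rank1Residual.Additive
  Summit.BirchSwinnertonDyer.Rank1Residual.Supersingular.KuriharaTwist

namespace Summit.BirchSwinnertonDyer.Rank1Residual.Supersingular

/-- **`BSD(E,3)` for `9950f1` at the two-prime level `1531·1747`, STANDARD CURRENCY** (N6 TAM-DEFECT cell: X8, `r_an = 0`, `N = 9950`, `ord₃ ∏c_ℓ = 1`, `#Ш_an = 1`): exactly my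
record `bsdp_x8r0kim9_9950f1_n2674657` (`RankZeroKimTamDefectRecord9950f1LevelTwo.lean`, p320636; engines K j142524 + M j148459 on `hδ`) with its DATUM binder
`hδ : kuriharaNumber D.f 9 2674657 ψ ≠ 0` DISCHARGED IN THE KERNEL from the landed two-prime depth-2 record `certK9_X8r0_9950f1` + the rounding row `certRK9_X8r0_9950f1`
(`KuriharaTwistCertsK9PairN6.lean`, this gen; implementation 3d = engine no. 3, `δ̃ ≡ 3 (mod 9)` = engines K/M) + the engine's ENCLOSURE `hballL` of
`D'·c_∞·re(-81·L(E,1) + Σ_{j≠0} e_9(−jk)·τ(χ_j)·L_j(1))/(9·Ω⁺_f)` for the 9 bins (`A = (a_{1531} − 2)(a_{1747} − 2) = -81`, `D' = 2`, `c_∞ = 1`, margin ≤ 103·10^-21,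
radius ≤ 848·10^-13; `m₀ = 2339594257`) via prover B's `kuriharaNumber_pairLevel_ne_zero_of_ainvs_of_certifiedK_of_LValueBall` (rounding + algebra = kernel steps); good reduction at 3,
`1531, 1747 ∈ 𝒫₂` (`#Ẽ = 1539, 1737`, `countPointsFast`) and irreducibility (`surj_x8r0_9950f1_3`) re-derived in the kernel. BINDERS LEFT: the record's minus `hδ` plus `hballL`
(`hK25s` Kim 2025 OPEN; `hW` Wuthrich Prop. 21, `hGZK`, `hmod`, `h3per` published; `r_an = 0`, `htam`, `D`, `ψ` surjective at both primes). Per pair; nothing booked; X8 CONSTRUCTION-SHAPED.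
[claim: Kim2025RefinedTNC, status: under-review] [cite: Kim2025RefinedTNC, Thm. 1.1 (ANNOUNCED, OPEN binder)] [cite: Kim2022StructureSelmer, §1.2.2, §1.4.3 (PDF p. 7) and Thm. 1.9 (6)]
[cite: MazurTateTeitelbaum1986Invent, §I.8 (8.6)] [cite: Cremona2006, Table 1 (Cremona label 9950f1)] -/
theorem bsdp_x8r0kim9L_9950f1_n2674657
    (hK25s : Kim2025.thm11_kimShaLength_of_integralPeriod_OPEN) (hW : sha_dvd_analyticSha)
    (hGZK : rank_eq_analyticRank_of_analyticRank_le_one) (hmod : hasEntireLFunction_rat)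
    (h3per : realPeriodRat_eq_unit_mul_plusPeriod_three)
    (W : WeierstrassCurve ℚ) (hWeq : W = ⟨1, -1, 0, -787492, -268781584⟩) (hr : W.analyticRank = 0)
    (htam : 2 ≤ padicValNat 3 W.tamagawaProduct + 1)
    {N : ℕ} [NeZero N] (D : ModularParametrizationData W N)
    (ψ : (ℓ : ℕ) → (ZMod ℓ)ˣ →* Multiplicative (ZMod (3 ^ 2)))
    (hψ : ∀ ℓ ∈ (2674657 : ℕ).primeFactors, Function.Surjective (ψ ℓ))
    (hballL : ∀ (L : ZMod (3 ^ 2) → ℂ → ℂ), (∀ j, j ≠ 0 → Differentiable ℂ (L j)) →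
      (∀ j, j ≠ 0 → ∀ s : ℂ, 2 < s.re → L j s = twistedLSeries D.f (binChar 2674657 ψ j)⁻¹ s) →
      ∀ k < 3 ^ 2, ∃ mid rad : ℝ, rad ≤ ((848 : ℕ) : ℝ) / 10 ^ (13 : ℕ) ∧
        |mid - (([29048, 3632, -19452, 3632, 29048, 12222, -39550, -39550, 12222].getD k 0 : ℤ) : ℝ)| ≤ ((103 : ℕ) : ℝ) / 10 ^ (21 : ℕ) ∧
        |((2 : ℕ) : ℝ) * (((1 : ℕ) : ℝ) *
          ((((-81 : ℤ) : ℂ) * W.entireLFunction 1 +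
            ∑ j ∈ (Finset.univ : Finset (ZMod (3 ^ 2))).erase 0,
              ZMod.stdAddChar (-(j * (k : ZMod (3 ^ 2)))) *
                (gaussSum (binChar 2674657 ψ j) (ZMod.stdAddChar (N := 2674657)) * L j 1)).re /
            (((3 ^ 2 : ℕ) : ℝ) * plusPeriod D.f))) - mid| ≤ rad) : BSDp W 3 := by
  subst hWeq
  haveI : Fact (Nat.Prime 3) := ⟨by norm_num⟩
  haveI : Fact (Nat.Prime 1531) := ⟨by norm_num⟩
  haveI : Fact (Nat.Prime 1747) := ⟨by norm_num⟩
  haveI : NeZero (2674657 : ℕ) := ⟨by decide⟩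
  exact bsdp_x8r0kim9_9950f1_n2674657 (hK25s := hK25s) (hW := hW) (hGZK := hGZK) (hmod := hmod) (h3per := h3per)
    (W := ⟨1, -1, 0, -787492, -268781584⟩) (hWeq := rfl) (hr := hr) (htam := htam) (D := D) (ψ := ψ) (hψ := hψ)
    (hδ := kuriharaNumber_pairLevel_ne_zero_of_ainvs_of_certifiedK_of_LValueBall 1 (-1) 0 (-787492) (-268781584)
      (isGloballyMinimal_of_krausCriterion_bounded 1 (-1) 0 (-787492) (-268781584)
        (by decide +kernel) (by decide +kernel) (by decide +kernel))
      certK9_X8r0_9950f1 (List.Mem.head _) (by decide) (by decide)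
      certRK9_X8r0_9950f1 (List.Mem.head _) rfl rfl rfl rfl (by decide)
      (by decide) (np := 1) (countPoints_eq_of_fast (by decide +kernel)) (by decide)
      surj_x8r0_9950f1_3
      1531 1747 (by norm_num) (by norm_num)
      (by norm_num) (by norm_num) (by decide) (by decide) (n₁ := 1539) (countPoints_eq_of_fast (by decide +kernel)) (by decide)
      (by norm_num) (by norm_num) (by decide) (by decide) (n₂ := 1737) (countPoints_eq_of_fast (by decide +kernel)) (by decide)
      (A := -81) (by decide) D ψ
      (hψ 1531 (Nat.mem_primeFactors.mpr ⟨by norm_num, by norm_num, by norm_num⟩))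
      (hψ 1747 (Nat.mem_primeFactors.mpr ⟨by norm_num, by norm_num, by norm_num⟩)) hballL)

end Summit.BirchSwinnertonDyer.Rank1Residual.Supersingular

end
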